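import Literature.IUT.HodgeArakelov.BadPrimeGaussianMonoidsGenuineRecordRestrictionIsoOfEvaluation
import Literature.IUT.HodgeArakelov.BadPrimeGaussianMonoidsProofs4
import Literature.IUT.HodgeArakelov.BadPrimeGaussianMonoidsTorsionUnitsModelProofs

/-!
# [IUTchII] Cor 3.6 (ii), third display `Ψ_{†F^Θ_v,α} ⥲ Ψ^ι_env(M^Θ_*) ⥲ Ψ_ξ(M^Θ_*) ⥲ Ψ_{Fξ}(†F_v)` END-TO-END at the genuine
# `θ_env` data of `X̲̲_K` over `ℚ̄_pˣ` (any inversion family), every [IUTchII] §3 junction hypothesis of the restriction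
# isomorphism — (K), (R), (E), `hU`, `hUsurj`, `hinj`, `hq₀` — DERIVED from print-shaped inputs (proof-only)

S. Mochizuki, *Inter-universal Teichmüller theory II*, kurims Dec-2020 manuscript, Cor 3.6 (ii) p. 100 l. 26–60 (third display:
«by composing the Kummer isomorphisms … of Proposition 3.3, (i), (ii), with the restriction isomorphisms of Corollary 3.5, (ii),
one obtains a diagram of compatible morphisms»), Cor 3.6 (i) p. 99 l. 44–47 (`(Ψ_{†C_v})_t ⥲ Ψ_cns(M^Θ_*)_t`), Cor 3.5 (ii) p. 95,
Cor 2.8 (i) p. 82, Prop 3.3 (i) p. 90; [EtTh] Prop 1.3 / 1.4 (iii) (the theta class is the Kummer class of the theta function; its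
values) [cite: Mochizuki2012, Cor 3.6 (ii) p.100]. Claim key DISPUTED (D-0012); nothing disputed is asserted here. PROOF-ONLY
companion (abc-iut cell, layer L6, seat abc-iut-w5-d192 gen 4; node **IUTchII:Cor3.6(ii)**, sub-DAG row Cor-36.ii.r10, row
COR36-r10-GENUINE-OF-EVALUATION). NO definition, NO `Prop` fact, NO instance.

WHAT IS PROVED. This lineage's Cor-36.ii.r10 composite of record `exists_kummerRestrictionTransportIso'_ofKummer(_self)`
(`…Cor36Proofs3` v2, p423855) lives at abc-iut-L6-t2's abstraction with the Cor 3.5 (ii) junction inputs (K) `hκ hcns hκ₀`, (R) `hRκ`,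
(E) `hRθ hq₀` and `horb` as binders. HERE abc-iut-w4-d004's composite `exists_kummerRestrictionTransportIso'` (Proofs4, p413027)
is fed with abc-iut-w4-d004 gen 3's restriction isomorphism AT THE GENUINE `θ_env` DATA over `ℚ̄_pˣ` with every junction
hypothesis derived from print-shaped inputs, `exists_unique_restrictionIso'_toRecord_padic_of_evaluation` (p434055):
* **`exists_kummerRestrictionTransportIso'_toRecord_padic_of_evaluation`** — for ANY `†F^Θ_v`-side Kummer datum
  `K : Prop33KummerStatements (genuine record) F` (Prop 3.3 (i): `Ψ_{†F^Θ_v,α} ⥲ Ψ^{label α}_env(𝕄_*)`, abc-iut-L6-t2's REAL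
  field `kummerTheta`) and ANY Kummer copy `e : N ⥲ κ₀(O)` of the labeled constants (Cor 3.6 (i)), the COMPOSITE
  `Ψ_{†F^Θ_v,α} ⥲ Ψ_{Fξ}(†F_v)` exists and, read through the labeled copies `piIso Lbl e`, IS «restriction ∘ Kummer»; inputs =
  the evaluation sections `s_t` (continuous into `Π^tp_{Ÿ̲̲}`, common `φ₀`, `G_v` acting on `ℚ̄_pˣ` as through them, one with
  finite-index `ε`-image), the model data (`c`, `c₀` bijective, same underlying map; `O ≤ ℚ̄_pˣ`), a module of FUNCTIONS `Afun`
  with Kummer data `cf` and evaluations `ev_t` equivariant along `s_t`, the PRESENTATION `θ = κ_fun(fΘ)` of the theta class and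
  its VALUES `ev_t fΘ = q_t ∈ O` with `q_{t₀}` a non-unit ([EtTh] Prop 1.3 / 1.4 (iii)), `θ ∈ θ^{label α}_env(𝕄_*)`, `horb`;
* **`exists_kummerRestrictionTransportIso'_toRecord_padic_of_evaluation_self`** — the same with `(Ψ_{†C_v})` READ AS `O` itself
  and the Kummer copy = the `G_v`-level Kummer map `κ₀` onto its image (injective: abc-iut-w4-d004 `hκ₀_padic`, from
  abc-iut-w4-d007's Kummer injectivity) — J5 of SUBDAG-IUTchII-Prop-31-33-34 for the genuine `†F_v`.
* §0 (any constants module `A`, any `iota`): `htors_toRecord_family` (`M^μ_TM ⊆ M^×_TM`) and `horb_toRecord_family_of_orbit`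
  (`horb` from the RAW orbit clause of Prop 2.2 (ii) read in the limit, abc-iut-w4-d004 `ThetaEnvData.horb_toRecord_of_orbit`
  with `htors` discharged) — so that the `horb` binder below is one line at any produced datum.
Residual inputs of the row after this file = DATA only: the `†F^Θ_v`-side datum `K` (Prop 3.3 (i)), the evaluation/presentation
data of [EtTh] §1, and the raw orbit clause of Prop 2.2 (ii) (abc-iut-w5-d187 / w4-d010 `IotaInvariantTheta…` lineages).
HONEST FRAMING: composition of landed theorems; no side taken on [IUTchIII] Cor 3.12; typed ≠ proved ≠ endorsed.
-/

noncomputable section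

namespace Literature.IUT.HodgeArakelov

namespace EtaleLevels

open Literature.AnabelianGeometry.EtaleTheta CohomologySystemOfContH1 EtaleThetaDataOfSetting TemperedThetaMonoids
  BadPrimeGaussianMonoids

variable {p : ℕ} [Fact p.Prime] {D : Literature.AnabelianGeometry.EtaleTheta.ThetaSetting p}
  {E : D.EtaleThetaData} {l : ℕ} (C : E.DoubleUnderline l) (hC : D.Compat) (hS : D.Sec2Hyps)
  (hl : l.Prime) (hp2 : p ≠ 2) (hpl : p ≠ l) (hζ : ∃ ζ : D.K, IsPrimitiveRoot ζ (4 * l))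
  (mods : ∀ M : ℕ+, D.CyclotomeMod l M)
  (f : contCocycles D.toTheta D.DeltaTheta C.GtpYdduu) (hf : f ∈ C.rootCocycles hC)
  (hmods : ∀ (M M' : ℕ+) (h : (M : ℕ) ∣ (M' : ℕ)) (x : D.lDeltaTheta l),
    MuN.red p M M' h ((mods M').red x) = (mods M).red x)
  (h15 : Literature.AnabelianGeometry.EtaleTheta.ThetaSetting.Prop15iii E hC) (L : C.CuspLabels)
  (hZ : ∀ M : ℕ+, Nonempty (ModelCyclotomes.lDeltaQuot (C.rigidData (mods M) hC hS h15 L) ≃*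
    Literature.IUT.HodgeTheaters.ZHat))
  (hcharY : EtaleThetaDataOfSetting.PiYddCharacteristic C)
  (hlim : Function.Bijective (rigidLimHom C hC hS hl hp2 hpl hζ mods f hf hmods h15 L hZ))
  [(EtaleThetaDataOfSetting.PiYdd C).Normal]
  {Iota : Type}
  (iota : Iota → ((thetaEnvData C hC hS hl hp2 hpl hζ mods f hf hmods h15 L hZ hcharY hlim).D.coh.lim ≃+
    (thetaEnvData C hC hS hl hp2 hpl hζ mods f hf hmods h15 L hZ hcharY hlim).D.coh.lim))
  {Lbl : Type*} {P₀ : TopGroup.{0}} (φ₀ : P₀ →* D.GtpTheta) (s : Lbl → (P₀ →* Pi C))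
  (hι : ∀ t, Continuous ((MonoidHom.id (Pi C)).comp (s t)))
  (hN : ∀ t, (⊤ : Subgroup P₀).map ((MonoidHom.id (Pi C)).comp (s t)) ≤ PiYdd C)
  (hφ : ∀ t, (phi C).comp ((MonoidHom.id (Pi C)).comp (s t)) = φ₀)

/-! ### §0. `M^μ_TM ⊆ M^×_TM` and `horb` from the RAW orbit clause, for the record with ANY inversion family -/

section AnyConstants

variable {A : Type} [CommGroup A] [MulDistribMulAction (Pi C) A] [TopologicalSpace A] [RootableBy A ℕ]
  (c : CyclotomeCoefficients (phi C) (D.lDeltaTheta l) A)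
  (hA : ∀ b : A, IsOpen (MulAction.stabilizer (Pi C) b : Set (Pi C)))
  (hfi : ∀ b : A, (MulAction.stabilizer (Pi C) b).FiniteIndex)
  (O : Submonoid A)

/-- **`M^μ_TM ⊆ M^×_TM` for the record with ANY inversion family** ([IUTchII] Cor 1.12 p. 56 / Prop 3.1 (ii) p. 88): every
torsion element of the ambient module `lim_J H¹(Π^tp_{Ÿ̲̲} ∩ J, l·Δ_Θ)` is a unit of `Ψ_cns = κ(O)`, for bijective cyclotomic-
rigidity coefficients `c` and `O` containing the roots of unity with their inverses — abc-iut-w4-d004's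
`units_of_isOfFinOrder_ofKummerModel` (p422298) at `ψ = id`, `κ = h1LimKummerOn` by `rfl` (its v1-record instance is
`units_of_isOfFinOrder_thetaEnvRecordKummer`, p423317). [cite: NeukirchSchmidtWingberg2008, II §7] -/
theorem htors_toRecord_family (hc : Function.Bijective c.hom)
    (hOtors : ∀ a : A, IsOfFinOrder a → a ∈ O ∧ a⁻¹ ∈ O) :
    ∀ x : ((thetaEnvData C hC hS hl hp2 hpl hζ mods f hf hmods h15 L hZ hcharY hlim).toRecord
          (h1LimConjMulAut (phi C) (D.lDeltaTheta l) (PiYdd C))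
          (h1LimKummerOn (phi C) (D.lDeltaTheta l) (PiYdd C) c hA hfi O) iota).H,
      IsOfFinOrder x → x ∈ ((thetaEnvData C hC hS hl hp2 hpl hζ mods f hf hmods h15 L hZ hcharY hlim).toRecord
          (h1LimConjMulAut (phi C) (D.lDeltaTheta l) (PiYdd C))
          (h1LimKummerOn (phi C) (D.lDeltaTheta l) (PiYdd C) c hA hfi O) iota).units :=
  fun x hx => BadPrimeGaussianMonoids.units_of_isOfFinOrder_ofKummerModel
    ((thetaEnvData C hC hS hl hp2 hpl hζ mods f hf hmods h15 L hZ hcharY hlim).toRecord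
          (h1LimConjMulAut (phi C) (D.lDeltaTheta l) (PiYdd C))
          (h1LimKummerOn (phi C) (D.lDeltaTheta l) (PiYdd C) c hA hfi O) iota)
    (phi C) (D.lDeltaTheta l) (PiYdd C) c hA hfi (MulEquiv.refl _) O (h1LimKummerOn (phi C) (D.lDeltaTheta l) (PiYdd C) c hA hfi O) (fun _ => rfl)
    (ThetaEnvData.toRecord_constantMonoid _ _ _ _) hc hOtors x hx

/-- **`horb` for the record with ANY inversion family from the RAW orbit clause of Prop 2.2 (ii)** (Cor 2.8 (i) p. 82:
«`θ^ι(Π_v)` … a `μ_{2l}`-orbit», read in the limit: any two `ι`-invariants up to torsion of `θ(Π)` for the inversion action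
`iota i₀` differ by a torsion class) — abc-iut-w4-d004's `ThetaEnvData.horb_toRecord_of_orbit` (p432177) with its `htors` input
DISCHARGED by `htors_toRecord_family`: `θ^{i₀}_env(𝕄_*)` is one `M^×_TM`-orbit. [cite: Mochizuki2012, Cor 2.8 (i) p.82] -/
theorem horb_toRecord_family_of_orbit (hc : Function.Bijective c.hom)
    (hOtors : ∀ a : A, IsOfFinOrder a → a ∈ O ∧ a⁻¹ ∈ O) {i₀ : Iota}
    (horbit : ∀ x ∈ (thetaEnvData C hC hS hl hp2 hpl hζ mods f hf hmods h15 L hZ hcharY hlim).thetaIotaLim (iota i₀),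
      ∀ x' ∈ (thetaEnvData C hC hS hl hp2 hpl hζ mods f hf hmods h15 L hZ hcharY hlim).thetaIotaLim (iota i₀), IsOfFinAddOrder (x' - x))
    {θ : ((thetaEnvData C hC hS hl hp2 hpl hζ mods f hf hmods h15 L hZ hcharY hlim).toRecord
          (h1LimConjMulAut (phi C) (D.lDeltaTheta l) (PiYdd C))
          (h1LimKummerOn (phi C) (D.lDeltaTheta l) (PiYdd C) c hA hfi O) iota).H}
    (hθ : θ ∈ ((thetaEnvData C hC hS hl hp2 hpl hζ mods f hf hmods h15 L hZ hcharY hlim).toRecord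
          (h1LimConjMulAut (phi C) (D.lDeltaTheta l) (PiYdd C))
          (h1LimKummerOn (phi C) (D.lDeltaTheta l) (PiYdd C) c hA hfi O) iota).thetaEnv i₀) :
    ∀ θ' ∈ ((thetaEnvData C hC hS hl hp2 hpl hζ mods f hf hmods h15 L hZ hcharY hlim).toRecord
          (h1LimConjMulAut (phi C) (D.lDeltaTheta l) (PiYdd C))
          (h1LimKummerOn (phi C) (D.lDeltaTheta l) (PiYdd C) c hA hfi O) iota).thetaEnv i₀,
      ∃ u ∈ ((thetaEnvData C hC hS hl hp2 hpl hζ mods f hf hmods h15 L hZ hcharY hlim).toRecord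
          (h1LimConjMulAut (phi C) (D.lDeltaTheta l) (PiYdd C))
          (h1LimKummerOn (phi C) (D.lDeltaTheta l) (PiYdd C) c hA hfi O) iota).units, θ' = u * θ :=
  (thetaEnvData C hC hS hl hp2 hpl hζ mods f hf hmods h15 L hZ hcharY hlim).horb_toRecord_of_orbit
    (h1LimConjMulAut (phi C) (D.lDeltaTheta l) (PiYdd C)) (h1LimKummerOn (phi C) (D.lDeltaTheta l) (PiYdd C) c hA hfi O) iota horbit
    (htors_toRecord_family C hC hS hl hp2 hpl hζ mods f hf hmods h15 L hZ hcharY hlim iota c hA hfi O hc hOtors) hθ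

end AnyConstants

/-! ### §1. The third display at the genuine `θ_env` data over `ℚ̄_pˣ` -/

section Padic

variable [TopologicalSpace (PadicAlgCl p)ˣ]
  (c : CyclotomeCoefficients (phi C) (D.lDeltaTheta l) (PadicAlgCl p)ˣ)
  (hA : ∀ b : (PadicAlgCl p)ˣ, IsOpen (MulAction.stabilizer (Pi C) b : Set (Pi C)))
  (hfi : ∀ b : (PadicAlgCl p)ˣ, (MulAction.stabilizer (Pi C) b).FiniteIndex)
  (O : Submonoid (PadicAlgCl p)ˣ)
  [MulDistribMulAction P₀ (PadicAlgCl p)ˣ]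
  (c₀ : CyclotomeCoefficients φ₀ (D.lDeltaTheta l) (PadicAlgCl p)ˣ)
  (hA₀ : ∀ b : (PadicAlgCl p)ˣ, IsOpen (MulAction.stabilizer P₀ b : Set P₀))
  (hfi₀ : ∀ b : (PadicAlgCl p)ˣ, (MulAction.stabilizer P₀ b).FiniteIndex)
  -- the module of FUNCTIONS with its Kummer data over `Π^tp_{Ÿ̲̲}` (abc-iut-w4-d004 …RestrictionIsoOfEvaluation)
  {Afun : Type} [CommGroup Afun] [MulDistribMulAction (Pi C) Afun] [TopologicalSpace Afun] [RootableBy Afun ℕ]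
  (cf : CyclotomeCoefficients (phi C) (D.lDeltaTheta l) Afun)
  (hAf : ∀ a : Afun, IsOpen (MulAction.stabilizer (Pi C) a : Set (Pi C)))
  (hfif : ∀ a : Afun, (MulAction.stabilizer (Pi C) a).FiniteIndex)

/-- **[Cor-36.ii.r10] `Ψ_{†F^Θ_v,α} ⥲ Ψ^ι_env(𝕄_*) ⥲ Ψ_ξ(𝕄_*) ⥲ Ψ_{Fξ}(†F_v)` END-TO-END AT THE GENUINE `θ_env` DATA over `ℚ̄_pˣ`**
([IUTchII] Cor 3.6 (ii) third display, p. 100 l. 26–60), any inversion family `iota`: for ANY `†F^Θ_v`-side Kummer datum `K`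
(Prop 3.3 (i), abc-iut-L6-t2's `Prop33KummerStatements.kummerTheta`) over the genuine record and ANY Kummer copy `e : N ⥲ κ₀(O)` of
the labeled constants (Cor 3.6 (i)), the COMPOSITE `Φ : Ψ_{†F^Θ_v,α} ⥲ Ψ_{Fξ}(†F_v)` exists, pinned: `piIso e ∘ Φ = restriction ∘
kummerTheta`. The restriction isomorphism is abc-iut-w4-d004's `exists_unique_restrictionIso'_toRecord_padic_of_evaluation` —
(K), (R), (E), `hU`, `hUsurj`, `hinj`, `hq₀` ALL DERIVED from: the evaluation sections, the model data, a module of functions with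
Kummer data and evaluations equivariant along the sections, the presentation `θ = κ_fun(fΘ)` and the values `ev_t fΘ = q_t ∈ O`
(`q_{t₀}` non-unit), `θ ∈ θ^{label α}_env(𝕄_*)`, `horb`. [cite: Mochizuki2012, Cor 3.6 (ii) p.100] -/
theorem exists_kummerRestrictionTransportIso'_toRecord_padic_of_evaluation (hc : Function.Bijective c.hom)
    (hc₀ : Function.Bijective c₀.hom) (hc₀c : ∀ ζ, c₀.hom ζ = c.hom ζ)
    (hact : ∀ (t : Lbl) (g : P₀) (a : (PadicAlgCl p)ˣ), g • a = s t g • a) (t₁ : Lbl)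
    [((EtaleThetaDataOfSetting.aug C).comp (s t₁)).range.FiniteIndex]
    {F : TemperedFrobenioidThetaData.{0, 0} (modelSystem C hC hS hl hp2 hpl hζ mods f hf hmods h15 L hZ).PiX}
    (K : Prop33KummerStatements
      ((thetaEnvData C hC hS hl hp2 hpl hζ mods f hf hmods h15 L hZ hcharY hlim).toRecord
          (h1LimConjMulAut (phi C) (D.lDeltaTheta l) (PiYdd C))
          (h1LimKummerOn (phi C) (D.lDeltaTheta l) (PiYdd C) c hA hfi O) iota) F)
    (α : (modelSystem C hC hS hl hp2 hpl hζ mods f hf hmods h15 L hZ).PiX)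
    {θ : ((thetaEnvData C hC hS hl hp2 hpl hζ mods f hf hmods h15 L hZ hcharY hlim).toRecord
          (h1LimConjMulAut (phi C) (D.lDeltaTheta l) (PiYdd C))
          (h1LimKummerOn (phi C) (D.lDeltaTheta l) (PiYdd C) c hA hfi O) iota).H}
    (hθ : θ ∈ ((thetaEnvData C hC hS hl hp2 hpl hζ mods f hf hmods h15 L hZ hcharY hlim).toRecord
          (h1LimConjMulAut (phi C) (D.lDeltaTheta l) (PiYdd C))
          (h1LimKummerOn (phi C) (D.lDeltaTheta l) (PiYdd C) c hA hfi O) iota).thetaEnv (K.label α))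
    (horb : ∀ θ' ∈ ((thetaEnvData C hC hS hl hp2 hpl hζ mods f hf hmods h15 L hZ hcharY hlim).toRecord
          (h1LimConjMulAut (phi C) (D.lDeltaTheta l) (PiYdd C))
          (h1LimKummerOn (phi C) (D.lDeltaTheta l) (PiYdd C) c hA hfi O) iota).thetaEnv (K.label α),
      ∃ u ∈ ((thetaEnvData C hC hS hl hp2 hpl hζ mods f hf hmods h15 L hZ hcharY hlim).toRecord
          (h1LimConjMulAut (phi C) (D.lDeltaTheta l) (PiYdd C))
          (h1LimKummerOn (phi C) (D.lDeltaTheta l) (PiYdd C) c hA hfi O) iota).units, θ' = u * θ)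
    (R : Lbl → (((thetaEnvData C hC hS hl hp2 hpl hζ mods f hf hmods h15 L hZ hcharY hlim).toRecord
          (h1LimConjMulAut (phi C) (D.lDeltaTheta l) (PiYdd C))
          (h1LimKummerOn (phi C) (D.lDeltaTheta l) (PiYdd C) c hA hfi O) iota).H →*
      Multiplicative (h1Lim φ₀ (D.lDeltaTheta l) (⊤ : Subgroup P₀) ⊥)))
    (hR : ∀ t y, Multiplicative.toAdd (R t y) =
      h1LimCongr (D.lDeltaTheta l) ⊤ (hφ t) ⊥
        (h1LimComap (phi C) (D.lDeltaTheta l) ((MonoidHom.id (Pi C)).comp (s t)) (hι t) (hN t)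
          (AddEquiv.additiveMultiplicative (h1Lim (phi C) (D.lDeltaTheta l) (PiYdd C) ⊥) (Additive.ofMul y))))
    (ev : Lbl → (Afun →* (PadicAlgCl p)ˣ)) (hev : ∀ (t : Lbl) (g : P₀) (a : Afun), ev t (s t g • a) = g • ev t a)
    (hcev : ∀ (t : Lbl) (ζ : cyclotome Afun), c₀.hom (cyclotome.map (ev t) ζ) = cf.hom ζ)
    {fΘ : Afun}
    (hθf : AddEquiv.additiveMultiplicative (h1Lim (phi C) (D.lDeltaTheta l) (PiYdd C) ⊥) (Additive.ofMul θ) =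
      Multiplicative.toAdd (h1LimKummer (phi C) (D.lDeltaTheta l) (PiYdd C) cf hAf hfif fΘ))
    (q : Lbl → O) (hval : ∀ t, ev t fΘ = (q t : (PadicAlgCl p)ˣ)) (t₀ : Lbl) (hq : ¬ IsUnit (q t₀))
    {N : Type*} [CommMonoid N] (e : N ≃* MonoidHom.mrange (h1LimKummerOn φ₀ (D.lDeltaTheta l) ⊤ c₀ hA₀ hfi₀ O)) :
    ∃ Φ : F.frobThetaMonoid α ≃*
        frobenioidGaussianMonoid e (fun t =>
          (fun t =>
          ((R t).comp (((thetaEnvData C hC hS hl hp2 hpl hζ mods f hf hmods h15 L hZ hcharY hlim).toRecord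
          (h1LimConjMulAut (phi C) (D.lDeltaTheta l) (PiYdd C))
          (h1LimKummerOn (phi C) (D.lDeltaTheta l) (PiYdd C) c hA hfi O) iota).thetaMonoid (K.label α)).subtype).codRestrict
            (MonoidHom.mrange (h1LimKummerOn φ₀ (D.lDeltaTheta l) ⊤ c₀ hA₀ hfi₀ O))
            (restriction_mem_mrange_gen
              ((thetaEnvData C hC hS hl hp2 hpl hζ mods f hf hmods h15 L hZ hcharY hlim).toRecord
          (h1LimConjMulAut (phi C) (D.lDeltaTheta l) (PiYdd C))
          (h1LimKummerOn (phi C) (D.lDeltaTheta l) (PiYdd C) c hA hfi O) iota)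
              (h1LimKummerOn (phi C) (D.lDeltaTheta l) (PiYdd C) c hA hfi O)
              (h1LimKummerOn φ₀ (D.lDeltaTheta l) ⊤ c₀ hA₀ hfi₀ O)
              (fun t => (R t).comp (((thetaEnvData C hC hS hl hp2 hpl hζ mods f hf hmods h15 L hZ hcharY hlim).toRecord
          (h1LimConjMulAut (phi C) (D.lDeltaTheta l) (PiYdd C))
          (h1LimKummerOn (phi C) (D.lDeltaTheta l) (PiYdd C) c hA hfi O) iota).thetaMonoid (K.label α)).subtype)
              q (hκ_padic C c hA hfi O hc) (ThetaEnvData.toRecord_constantMonoid _ _ _ _) hθ horb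
              (fun t m hm => hRκ_toRecord C hC hS hl hp2 hpl hζ mods f hf hmods h15 L hZ hcharY hlim iota φ₀ s hι hN hφ c
                hA hfi O c₀ hA₀ hfi₀ hc₀c hact R hR t m hm)
              (fun t => hRθ_toRecord_of_evaluation C hC hS hl hp2 hpl hζ mods f hf hmods h15 L hZ hcharY hlim iota φ₀ s hι hN
                hφ c hA hfi O c₀ hA₀ hfi₀ cf hAf hfif R hR ev hev hcev hθf q hval t) t)) t
            ⟨θ, thetaEnv_subset_thetaMonoid
              ((thetaEnvData C hC hS hl hp2 hpl hζ mods f hf hmods h15 L hZ hcharY hlim).toRecord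
          (h1LimConjMulAut (phi C) (D.lDeltaTheta l) (PiYdd C))
          (h1LimKummerOn (phi C) (D.lDeltaTheta l) (PiYdd C) c hA hfi O) iota) (K.label α) hθ⟩),
      ∀ x, piIso Lbl e ((Φ x : frobenioidGaussianMonoid e _) : Lbl → N) =
        MonoidHom.pi
          (fun t =>
          ((R t).comp (((thetaEnvData C hC hS hl hp2 hpl hζ mods f hf hmods h15 L hZ hcharY hlim).toRecord
          (h1LimConjMulAut (phi C) (D.lDeltaTheta l) (PiYdd C))
          (h1LimKummerOn (phi C) (D.lDeltaTheta l) (PiYdd C) c hA hfi O) iota).thetaMonoid (K.label α)).subtype).codRestrict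
            (MonoidHom.mrange (h1LimKummerOn φ₀ (D.lDeltaTheta l) ⊤ c₀ hA₀ hfi₀ O))
            (restriction_mem_mrange_gen
              ((thetaEnvData C hC hS hl hp2 hpl hζ mods f hf hmods h15 L hZ hcharY hlim).toRecord
          (h1LimConjMulAut (phi C) (D.lDeltaTheta l) (PiYdd C))
          (h1LimKummerOn (phi C) (D.lDeltaTheta l) (PiYdd C) c hA hfi O) iota)
              (h1LimKummerOn (phi C) (D.lDeltaTheta l) (PiYdd C) c hA hfi O)
              (h1LimKummerOn φ₀ (D.lDeltaTheta l) ⊤ c₀ hA₀ hfi₀ O)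
              (fun t => (R t).comp (((thetaEnvData C hC hS hl hp2 hpl hζ mods f hf hmods h15 L hZ hcharY hlim).toRecord
          (h1LimConjMulAut (phi C) (D.lDeltaTheta l) (PiYdd C))
          (h1LimKummerOn (phi C) (D.lDeltaTheta l) (PiYdd C) c hA hfi O) iota).thetaMonoid (K.label α)).subtype)
              q (hκ_padic C c hA hfi O hc) (ThetaEnvData.toRecord_constantMonoid _ _ _ _) hθ horb
              (fun t m hm => hRκ_toRecord C hC hS hl hp2 hpl hζ mods f hf hmods h15 L hZ hcharY hlim iota φ₀ s hι hN hφ c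
                hA hfi O c₀ hA₀ hfi₀ hc₀c hact R hR t m hm)
              (fun t => hRθ_toRecord_of_evaluation C hC hS hl hp2 hpl hζ mods f hf hmods h15 L hZ hcharY hlim iota φ₀ s hι hN
                hφ c hA hfi O c₀ hA₀ hfi₀ cf hAf hfif R hR ev hev hcev hθf q hval t) t))
          (K.kummerTheta α x) := by
  obtain ⟨eΨ, heΨ, -⟩ :=
    exists_unique_restrictionIso'_toRecord_padic_of_evaluation C hC hS hl hp2 hpl hζ mods f hf hmods h15 L hZ hcharY hlim iota φ₀ s hι hN hφ c hA hfi O c₀ hA₀ hfi₀ cf hAf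
      hfif hc hc₀ hc₀c hact t₁ hθ horb R hR ev hev hcev hθf q hval t₀ hq
  exact exists_kummerRestrictionTransportIso' K α _ eΨ heΨ e

/-- **The same with the Frobenioid-side constant monoid `(Ψ_{†C_v})` READ AS `O` itself** and the Kummer copy = the `G_v`-level
Kummer map `κ₀ : O → lim H¹(Π₀ ∩ ·, l·Δ_Θ)_{φ₀}` onto its image — injective by abc-iut-w4-d004's `hκ₀_padic` (abc-iut-w4-d007's
Kummer injectivity over a section with finite-index `ε`-image); the identification of `Ψ_{†C_v}` with `𝒪^▷` is J5 of
SUBDAG-IUTchII-Prop-31-33-34 for the genuine `†F_v` (Cor 3.6 (i) p. 99 l. 44–47 «`(Ψ_{†C_v})_t ⥲ Ψ_cns(M^Θ_*)_t`»).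
[cite: Mochizuki2012, Cor 3.6 (ii) p.100] -/
theorem exists_kummerRestrictionTransportIso'_toRecord_padic_of_evaluation_self (hc : Function.Bijective c.hom)
    (hc₀ : Function.Bijective c₀.hom) (hc₀c : ∀ ζ, c₀.hom ζ = c.hom ζ)
    (hact : ∀ (t : Lbl) (g : P₀) (a : (PadicAlgCl p)ˣ), g • a = s t g • a) (t₁ : Lbl)
    [((EtaleThetaDataOfSetting.aug C).comp (s t₁)).range.FiniteIndex]
    {F : TemperedFrobenioidThetaData.{0, 0} (modelSystem C hC hS hl hp2 hpl hζ mods f hf hmods h15 L hZ).PiX}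
    (K : Prop33KummerStatements
      ((thetaEnvData C hC hS hl hp2 hpl hζ mods f hf hmods h15 L hZ hcharY hlim).toRecord
          (h1LimConjMulAut (phi C) (D.lDeltaTheta l) (PiYdd C))
          (h1LimKummerOn (phi C) (D.lDeltaTheta l) (PiYdd C) c hA hfi O) iota) F)
    (α : (modelSystem C hC hS hl hp2 hpl hζ mods f hf hmods h15 L hZ).PiX)
    {θ : ((thetaEnvData C hC hS hl hp2 hpl hζ mods f hf hmods h15 L hZ hcharY hlim).toRecord
          (h1LimConjMulAut (phi C) (D.lDeltaTheta l) (PiYdd C))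
          (h1LimKummerOn (phi C) (D.lDeltaTheta l) (PiYdd C) c hA hfi O) iota).H}
    (hθ : θ ∈ ((thetaEnvData C hC hS hl hp2 hpl hζ mods f hf hmods h15 L hZ hcharY hlim).toRecord
          (h1LimConjMulAut (phi C) (D.lDeltaTheta l) (PiYdd C))
          (h1LimKummerOn (phi C) (D.lDeltaTheta l) (PiYdd C) c hA hfi O) iota).thetaEnv (K.label α))
    (horb : ∀ θ' ∈ ((thetaEnvData C hC hS hl hp2 hpl hζ mods f hf hmods h15 L hZ hcharY hlim).toRecord
          (h1LimConjMulAut (phi C) (D.lDeltaTheta l) (PiYdd C))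
          (h1LimKummerOn (phi C) (D.lDeltaTheta l) (PiYdd C) c hA hfi O) iota).thetaEnv (K.label α),
      ∃ u ∈ ((thetaEnvData C hC hS hl hp2 hpl hζ mods f hf hmods h15 L hZ hcharY hlim).toRecord
          (h1LimConjMulAut (phi C) (D.lDeltaTheta l) (PiYdd C))
          (h1LimKummerOn (phi C) (D.lDeltaTheta l) (PiYdd C) c hA hfi O) iota).units, θ' = u * θ)
    (R : Lbl → (((thetaEnvData C hC hS hl hp2 hpl hζ mods f hf hmods h15 L hZ hcharY hlim).toRecord
          (h1LimConjMulAut (phi C) (D.lDeltaTheta l) (PiYdd C))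
          (h1LimKummerOn (phi C) (D.lDeltaTheta l) (PiYdd C) c hA hfi O) iota).H →*
      Multiplicative (h1Lim φ₀ (D.lDeltaTheta l) (⊤ : Subgroup P₀) ⊥)))
    (hR : ∀ t y, Multiplicative.toAdd (R t y) =
      h1LimCongr (D.lDeltaTheta l) ⊤ (hφ t) ⊥
        (h1LimComap (phi C) (D.lDeltaTheta l) ((MonoidHom.id (Pi C)).comp (s t)) (hι t) (hN t)
          (AddEquiv.additiveMultiplicative (h1Lim (phi C) (D.lDeltaTheta l) (PiYdd C) ⊥) (Additive.ofMul y))))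
    (ev : Lbl → (Afun →* (PadicAlgCl p)ˣ)) (hev : ∀ (t : Lbl) (g : P₀) (a : Afun), ev t (s t g • a) = g • ev t a)
    (hcev : ∀ (t : Lbl) (ζ : cyclotome Afun), c₀.hom (cyclotome.map (ev t) ζ) = cf.hom ζ)
    {fΘ : Afun}
    (hθf : AddEquiv.additiveMultiplicative (h1Lim (phi C) (D.lDeltaTheta l) (PiYdd C) ⊥) (Additive.ofMul θ) =
      Multiplicative.toAdd (h1LimKummer (phi C) (D.lDeltaTheta l) (PiYdd C) cf hAf hfif fΘ))
    (q : Lbl → O) (hval : ∀ t, ev t fΘ = (q t : (PadicAlgCl p)ˣ)) (t₀ : Lbl) (hq : ¬ IsUnit (q t₀)) :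
    ∃ (e : O ≃* MonoidHom.mrange (h1LimKummerOn φ₀ (D.lDeltaTheta l) ⊤ c₀ hA₀ hfi₀ O))
      (Φ : F.frobThetaMonoid α ≃*
        frobenioidGaussianMonoid e (fun t =>
          (fun t =>
          ((R t).comp (((thetaEnvData C hC hS hl hp2 hpl hζ mods f hf hmods h15 L hZ hcharY hlim).toRecord
          (h1LimConjMulAut (phi C) (D.lDeltaTheta l) (PiYdd C))
          (h1LimKummerOn (phi C) (D.lDeltaTheta l) (PiYdd C) c hA hfi O) iota).thetaMonoid (K.label α)).subtype).codRestrict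
            (MonoidHom.mrange (h1LimKummerOn φ₀ (D.lDeltaTheta l) ⊤ c₀ hA₀ hfi₀ O))
            (restriction_mem_mrange_gen
              ((thetaEnvData C hC hS hl hp2 hpl hζ mods f hf hmods h15 L hZ hcharY hlim).toRecord
          (h1LimConjMulAut (phi C) (D.lDeltaTheta l) (PiYdd C))
          (h1LimKummerOn (phi C) (D.lDeltaTheta l) (PiYdd C) c hA hfi O) iota)
              (h1LimKummerOn (phi C) (D.lDeltaTheta l) (PiYdd C) c hA hfi O)
              (h1LimKummerOn φ₀ (D.lDeltaTheta l) ⊤ c₀ hA₀ hfi₀ O)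
              (fun t => (R t).comp (((thetaEnvData C hC hS hl hp2 hpl hζ mods f hf hmods h15 L hZ hcharY hlim).toRecord
          (h1LimConjMulAut (phi C) (D.lDeltaTheta l) (PiYdd C))
          (h1LimKummerOn (phi C) (D.lDeltaTheta l) (PiYdd C) c hA hfi O) iota).thetaMonoid (K.label α)).subtype)
              q (hκ_padic C c hA hfi O hc) (ThetaEnvData.toRecord_constantMonoid _ _ _ _) hθ horb
              (fun t m hm => hRκ_toRecord C hC hS hl hp2 hpl hζ mods f hf hmods h15 L hZ hcharY hlim iota φ₀ s hι hN hφ c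
                hA hfi O c₀ hA₀ hfi₀ hc₀c hact R hR t m hm)
              (fun t => hRθ_toRecord_of_evaluation C hC hS hl hp2 hpl hζ mods f hf hmods h15 L hZ hcharY hlim iota φ₀ s hι hN
                hφ c hA hfi O c₀ hA₀ hfi₀ cf hAf hfif R hR ev hev hcev hθf q hval t) t)) t
            ⟨θ, thetaEnv_subset_thetaMonoid
              ((thetaEnvData C hC hS hl hp2 hpl hζ mods f hf hmods h15 L hZ hcharY hlim).toRecord
          (h1LimConjMulAut (phi C) (D.lDeltaTheta l) (PiYdd C))
          (h1LimKummerOn (phi C) (D.lDeltaTheta l) (PiYdd C) c hA hfi O) iota) (K.label α) hθ⟩)),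
      (∀ m : O, ((e m : MonoidHom.mrange (h1LimKummerOn φ₀ (D.lDeltaTheta l) ⊤ c₀ hA₀ hfi₀ O)) :
          Multiplicative (h1Lim φ₀ (D.lDeltaTheta l) (⊤ : Subgroup P₀) ⊥)) = (h1LimKummerOn φ₀ (D.lDeltaTheta l) ⊤ c₀ hA₀ hfi₀ O) m) ∧
      ∀ x, piIso Lbl e ((Φ x : frobenioidGaussianMonoid e _) : Lbl → O) =
        MonoidHom.pi
          (fun t =>
          ((R t).comp (((thetaEnvData C hC hS hl hp2 hpl hζ mods f hf hmods h15 L hZ hcharY hlim).toRecord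
          (h1LimConjMulAut (phi C) (D.lDeltaTheta l) (PiYdd C))
          (h1LimKummerOn (phi C) (D.lDeltaTheta l) (PiYdd C) c hA hfi O) iota).thetaMonoid (K.label α)).subtype).codRestrict
            (MonoidHom.mrange (h1LimKummerOn φ₀ (D.lDeltaTheta l) ⊤ c₀ hA₀ hfi₀ O))
            (restriction_mem_mrange_gen
              ((thetaEnvData C hC hS hl hp2 hpl hζ mods f hf hmods h15 L hZ hcharY hlim).toRecord
          (h1LimConjMulAut (phi C) (D.lDeltaTheta l) (PiYdd C))
          (h1LimKummerOn (phi C) (D.lDeltaTheta l) (PiYdd C) c hA hfi O) iota)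
              (h1LimKummerOn (phi C) (D.lDeltaTheta l) (PiYdd C) c hA hfi O)
              (h1LimKummerOn φ₀ (D.lDeltaTheta l) ⊤ c₀ hA₀ hfi₀ O)
              (fun t => (R t).comp (((thetaEnvData C hC hS hl hp2 hpl hζ mods f hf hmods h15 L hZ hcharY hlim).toRecord
          (h1LimConjMulAut (phi C) (D.lDeltaTheta l) (PiYdd C))
          (h1LimKummerOn (phi C) (D.lDeltaTheta l) (PiYdd C) c hA hfi O) iota).thetaMonoid (K.label α)).subtype)
              q (hκ_padic C c hA hfi O hc) (ThetaEnvData.toRecord_constantMonoid _ _ _ _) hθ horb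
              (fun t m hm => hRκ_toRecord C hC hS hl hp2 hpl hζ mods f hf hmods h15 L hZ hcharY hlim iota φ₀ s hι hN hφ c
                hA hfi O c₀ hA₀ hfi₀ hc₀c hact R hR t m hm)
              (fun t => hRθ_toRecord_of_evaluation C hC hS hl hp2 hpl hζ mods f hf hmods h15 L hZ hcharY hlim iota φ₀ s hι hN
                hφ c hA hfi O c₀ hA₀ hfi₀ cf hAf hfif R hR ev hev hcev hθf q hval t) t))
          (K.kummerTheta α x) := by
  have hκ₀ : Function.Injective (h1LimKummerOn φ₀ (D.lDeltaTheta l) ⊤ c₀ hA₀ hfi₀ O) :=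
    hκ₀_padic (C := C) (O := O) (φ₀ := φ₀) (s := s) (hι := hι) (c₀ := c₀) (hA₀ := hA₀) (hfi₀ := hfi₀) hc₀ t₁ (hact t₁)
  let e : O ≃* MonoidHom.mrange (h1LimKummerOn φ₀ (D.lDeltaTheta l) ⊤ c₀ hA₀ hfi₀ O) :=
    MulEquiv.ofBijective (h1LimKummerOn φ₀ (D.lDeltaTheta l) ⊤ c₀ hA₀ hfi₀ O).mrangeRestrict
      ⟨fun _ _ h => hκ₀ (congrArg Subtype.val h), (h1LimKummerOn φ₀ (D.lDeltaTheta l) ⊤ c₀ hA₀ hfi₀ O).mrangeRestrict_surjective⟩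
  obtain ⟨Φ, hΦ⟩ :=
    exists_kummerRestrictionTransportIso'_toRecord_padic_of_evaluation C hC hS hl hp2 hpl hζ mods f hf hmods h15 L hZ hcharY hlim iota φ₀ s hι hN hφ c hA hfi O c₀ hA₀ hfi₀
      cf hAf hfif hc hc₀ hc₀c hact t₁ K α hθ horb R hR ev hev hcev hθf q hval t₀ hq e
  exact ⟨e, Φ, fun _ => rfl, hΦ⟩

end Padic

end EtaleLevels

end Literature.IUT.HodgeArakelov

end
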